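import Mathlib
import Summits.PneNP.PneNP.Theses.AeaCutRectangles
import Summits.PneNP.PneNP.Theorems.AeaCutRectanglesDutyRectangles

/-!
# Crux-ideate round 2, seat 2, g7 — Lean companion (`stmt-PneNP-19727`, `AeaCutRectangles.FoolingMeasure`)

FRONTIER restricted-model rung (AEA cut rectangles vs NON-3-COL).  Nothing here bears on P vs NP.

Three cards:
* `seam-pair-immunity` — hole seams are IN every capturing duty, non-hole seams are OUT (proved), hence every
  capturing duty reads every run terminal of every ruler individually (proved: `duty_reads_runStart/End`,
  `junta_reads_runStart`); profile (symmetric) duties must pin a vertex in every balanced seam window (typed).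
* `cayley-clique-model` — normality of a cycle system is exactly pairwise adjacency of its rulers in the Cayley
  graph `Cay(Sym(3q+1), S_D)`, `S_D` = permutations that are `D`-stepped together with their inverse,
  `D = {d : d ≡ 2 (mod 3)}` (proved: `normal_iff_dStepped`, `normal_iff_pairwise_cayleyAdj`).
* `two-sided-link-ladder` — the two-sided link class of a member at a cut and the darkness predicate whose truth for a
  fixed `t` would refute `X1(μ_t)` asymptotically (typed: `TwoSidedClass`, `TwoSidedDark`).
-/

set_option linter.dupNamespace false

namespace Summit.PneNP.PneNP.Cruxes.FoolingMeasure.IdeasR2s2g7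

/-! ## Minimal mirror of `Cruxes/FoolingMeasure/NormalCycleSystems.lean` (seat 2, g3/g4; namespace `IdeasR2g3`),
re-declared verbatim so that this file is self-contained on the farm (Cruxes files are not built there). -/

open Finset
open Fin.CommRing
open Summit.PneNP.PneNP.Theorems.AeaCutRectanglesDutyRectangles (bobSide)

/-- 3-colourability of the graph spanned by an edge set over `Fin n` (as in the route file). -/
abbrev Col3 {n : ℕ} (G : Finset (Sym2 (Fin n))) : Prop :=
  (SimpleGraph.fromEdgeSet (G : Set (Sym2 (Fin n)))).Colorable 3

/-- `t` rulers of `Fin (3q+1)`: `pos k v` is the index of `v` along cycle `k`. -/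
structure CycleSystem (q t : ℕ) where
  pos : Fin t → Equiv.Perm (Fin (3 * q + 1))

namespace CycleSystem

variable {q t : ℕ} (S : CycleSystem q t)

/-- successor of `v` along cycle `k`. -/
def succ (k : Fin t) (v : Fin (3 * q + 1)) : Fin (3 * q + 1) := (S.pos k).symm (S.pos k v + 1)

/-- the graph of the system: the union of its `t` Hamiltonian cycles, as an edge set. -/
def edges : Finset (Sym2 (Fin (3 * q + 1))) :=
  (Finset.univ : Finset (Fin t × Fin (3 * q + 1))).image fun p => s(p.2, S.succ p.1 p.2)

/-- NORMALITY ("jump ≡ 2 mod 3"): along ruler `i`, each edge of each other cycle `k` spans a forward distance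
`≡ 2 (mod 3)` (the condition is symmetric in the edge's endpoints since `3q+1 ≡ 1 (mod 3)`). -/
def Normal : Prop :=
  ∀ i k : Fin t, i ≠ k → ∀ v : Fin (3 * q + 1), (S.pos i (S.succ k v) - S.pos i v).val % 3 = 2

theorem pos_succ (k : Fin t) (v : Fin (3 * q + 1)) : S.pos k (S.succ k v) = S.pos k v + 1 := by
  simp [succ]

end CycleSystem

variable {q t : ℕ}

/-- the seam colouring of ruler `k` based at the edge `{v, succ_k v}`: colour(w) = (pos_k w − pos_k v − 1) mod 3.
It is proper on every edge of a normal system except `{v, succ_k v}` itself. -/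
def seamColour (S : CycleSystem q t) (k : Fin t) (v w : Fin (3 * q + 1)) : Fin 3 :=
  ⟨(S.pos k w - S.pos k v - 1).val % 3, Nat.mod_lt _ (by norm_num)⟩

theorem seam_proper (S : CycleSystem q t) (hq : 1 ≤ q) (hN : S.Normal) (k : Fin t) (v : Fin (3 * q + 1))
    (i : Fin t) (u : Fin (3 * q + 1)) (hu : ¬ (i = k ∧ u = v)) :
    seamColour S k v u ≠ seamColour S k v (S.succ i u) := by
  intro h
  have hval : (S.pos k u - S.pos k v - 1).val % 3 = (S.pos k (S.succ i u) - S.pos k v - 1).val % 3 :=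
    congrArg Fin.val h
  have hB : S.pos k (S.succ i u) - S.pos k v - 1 =
      (S.pos k u - S.pos k v - 1) + (S.pos k (S.succ i u) - S.pos k u) := by ring
  rw [hB, Fin.val_add] at hval
  set A := S.pos k u - S.pos k v - 1 with hA
  set D := S.pos k (S.succ i u) - S.pos k u with hD
  have hAlt := A.isLt
  have hDlt := D.isLt
  by_cases hik : i = k
  · subst hik
    have hD1 : D = 1 := by rw [hD, S.pos_succ]; ring
    have huv : u ≠ v := fun h' => hu ⟨rfl, h'⟩
    have h1v : (1 : Fin (3 * q + 1)).val = 1 := by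
      rw [Fin.val_one']; exact Nat.mod_eq_of_lt (by omega)
    have hA3q : A.val ≠ 3 * q := by
      intro h3
      apply huv
      have hneg : A = -1 := by
        apply Fin.ext
        rw [h3, Fin.coe_neg_one]
      have hpos : S.pos i u = S.pos i v := by
        have := hneg
        rw [hA] at this
        linear_combination this
      exact (S.pos i).injective hpos
    have hA1 : A.val + 1 < 3 * q + 1 := by omega
    rw [hD1, h1v, Nat.mod_eq_of_lt hA1] at hval
    omega
  · have hD2 : D.val % 3 = 2 := hN k i (Ne.symm hik) u
    by_cases hlt : A.val + D.val < 3 * q + 1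
    · rw [Nat.mod_eq_of_lt hlt] at hval
      omega
    · have hmod : (A.val + D.val) % (3 * q + 1) = A.val + D.val - (3 * q + 1) := by
        rw [Nat.mod_eq_sub_mod (by omega)]
        exact Nat.mod_eq_of_lt (by omega)
      rw [hmod] at hval
      omega



/-! ### Seam adjacency (the kernel of the interface-certificate lower bound in the card)
Moving the seam of ruler `k` across ONE vertex `b = succ_k a` changes the seam colouring only at `b`
(up to the global colour shift `c ↦ c + 2`): consecutive members of the ruler family are Hamming-adjacent. -/

theorem seamColour_shift (S : CycleSystem q t) (hq : 1 ≤ q) (k : Fin t) (a w : Fin (3 * q + 1))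
    (hw : w ≠ S.succ k a) :
    (seamColour S k (S.succ k a) w).val = ((seamColour S k a w).val + 2) % 3 := by
  unfold seamColour
  simp only
  have h1v : (1 : Fin (3 * q + 1)).val = 1 := by
    rw [Fin.val_one']; exact Nat.mod_eq_of_lt (by omega)
  set X := S.pos k w - S.pos k a - 1 with hX
  have hXb : S.pos k w - S.pos k (S.succ k a) - 1 = X - 1 := by
    rw [S.pos_succ]; ring
  rw [hXb]
  have hX0 : X.val ≠ 0 := by
    intro h0
    apply hw
    have hX0' : X = 0 := Fin.ext (by rw [h0]; rfl)
    have : S.pos k w = S.pos k a + 1 := by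
      rw [hX] at hX0'
      linear_combination hX0'
    rw [← S.pos_succ] at this
    exact (S.pos k).injective this
  have hXlt := X.isLt
  rw [Fin.coe_sub_iff_le.2 (by
    change (1 : Fin (3 * q + 1)).val ≤ X.val
    rw [h1v]; omega), h1v]
  omega

/-! ### Normality is symmetric; normal systems are triangle-free (g4)
Because `3q+1 ≡ 1 (mod 3)`, a jump `d` satisfies `d ≡ 2 (mod 3)` iff the reverse jump `3q+1-d` does: normality is a
condition on UNORDERED pairs.  Consequence: the graph of a normal system has no triangle (two edges of a triangle leave
a common vertex towards the two ends of the third edge, which are consecutive in some ruler, so the two jumps differ by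
one and cannot both be `≡ 2`).  So the proposed measure lives on triangle-free `2t`-regular graphs, 4-critical when not
3-colourable. -/

open Summit.PneNP.PneNP.Theorems.AeaCutRectanglesDutyRectangles (dutyRect mem_dutyRect map_mk_isDiag_iff aliceSide)

/-! ## Card 1 — seam-pair immunity -/

/-- the seam colouring of ruler `k` based at `v`, rotated by the constant `κ`. -/
def seamRot (S : CycleSystem q t) (k : Fin t) (v : Fin (3 * q + 1)) (κ : Fin 3) (w : Fin (3 * q + 1)) : Fin 3 :=
  seamColour S k v w + κ

/-- In a normal system the only edge monochromatic under a (rotated) seam colouring is the seam edge itself. -/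
theorem seamRot_mono_edge (S : CycleSystem q t) (hq : 1 ≤ q) (hN : S.Normal) (k : Fin t) (v : Fin (3 * q + 1))
    (κ : Fin 3) {e : Sym2 (Fin (3 * q + 1))} (he : e ∈ S.edges) (hmono : (e.map (seamRot S k v κ)).IsDiag) :
    e = s(v, S.succ k v) := by
  obtain ⟨⟨i, u⟩, -, rfl⟩ := Finset.mem_image.mp he
  rw [map_mk_isDiag_iff] at hmono
  by_contra hne
  have key : ¬ (i = k ∧ u = v) := by
    rintro ⟨rfl, rfl⟩
    exact hne rfl
  apply seam_proper S hq hN k v i u key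
  have h' : seamColour S k v u + κ = seamColour S k v (S.succ i u) + κ := hmono
  exact add_right_cancel h'

/-- **Hole seams are in the duty.** If `S.edges ∈ dutyRect B Φ` and the seam edge `{v, succ_k v}` lies inside `B`,
every rotation of the seam colouring based at `v` belongs to `Φ` (it is proper on Alice's side). -/
theorem holeSeam_mem_duty (S : CycleSystem q t) (hq : 1 ≤ q) (hN : S.Normal) {B : Finset (Fin (3 * q + 1))}
    {Φ : Set (Fin (3 * q + 1) → Fin 3)} (hG : S.edges ∈ dutyRect B Φ) {k : Fin t} {v : Fin (3 * q + 1)}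
    (hv : v ∈ B) (hsv : S.succ k v ∈ B) (κ : Fin 3) : seamRot S k v κ ∈ Φ := by
  by_contra hΦ
  obtain ⟨e, he, ⟨w, hw, hwB⟩, hmono⟩ := (mem_dutyRect.mp hG).2.2 _ hΦ
  have hE := seamRot_mono_edge S hq hN k v κ he hmono
  subst hE
  rcases Sym2.mem_iff.mp hw with rfl | rfl
  · exact hwB hv
  · exact hwB hsv

/-- **Non-hole seams are outside the duty.** If the seam edge `{v, succ_k v}` is NOT inside `B`, no rotation of the
seam colouring based at `v` belongs to `Φ` (it is proper on Bob's side). -/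
theorem seam_not_mem_duty (S : CycleSystem q t) (hq : 1 ≤ q) (hN : S.Normal) {B : Finset (Fin (3 * q + 1))}
    {Φ : Set (Fin (3 * q + 1) → Fin 3)} (hG : S.edges ∈ dutyRect B Φ) {k : Fin t} {v : Fin (3 * q + 1)}
    (hv : ¬ (v ∈ B ∧ S.succ k v ∈ B)) (κ : Fin 3) : seamRot S k v κ ∉ Φ := by
  intro hΦ
  obtain ⟨e, he, hin, hmono⟩ := (mem_dutyRect.mp hG).2.1 _ hΦ
  have hE := seamRot_mono_edge S hq hN k v κ he hmono
  subst hE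
  exact hv ⟨hin v (Sym2.mem_mk_left _ _), hin _ (Sym2.mem_mk_right _ _)⟩

/-- consecutive seams agree, after rotation, everywhere except at the crossed vertex. -/
theorem seamRot_succ_agree (S : CycleSystem q t) (hq : 1 ≤ q) (k : Fin t) (a w : Fin (3 * q + 1))
    (hw : w ≠ S.succ k a) : seamRot S k (S.succ k a) 0 w = seamRot S k a 2 w := by
  apply Fin.ext
  have h := seamColour_shift S hq k a w hw
  simp only [seamRot, add_zero, Fin.val_add]
  rw [h]
  norm_num

/-- **Every capturing duty reads every run START.** If ruler `k` enters `B` at `b = succ_k a` (`a ∉ B`, `b ∈ B`) and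
continues inside (`succ_k b ∈ B`), then `Φ` contains a colouring and omits another that agree off `b`. -/
theorem duty_reads_runStart (S : CycleSystem q t) (hq : 1 ≤ q) (hN : S.Normal) {B : Finset (Fin (3 * q + 1))}
    {Φ : Set (Fin (3 * q + 1) → Fin 3)} (hG : S.edges ∈ dutyRect B Φ) {k : Fin t} {a : Fin (3 * q + 1)}
    (ha : a ∉ B) (hbB : S.succ k a ∈ B) (hb : S.succ k (S.succ k a) ∈ B) :
    ∃ c₁ ∈ Φ, ∃ c₂ ∉ Φ, ∀ w, w ≠ S.succ k a → c₁ w = c₂ w :=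
  ⟨seamRot S k (S.succ k a) 0, holeSeam_mem_duty S hq hN hG hbB hb 0,
   seamRot S k a 2, seam_not_mem_duty S hq hN hG (fun h => ha h.1) 2,
   fun w hw => seamRot_succ_agree S hq k a w hw⟩

/-- **Every capturing duty reads every run END.** If `a, succ_k a ∈ B` and `succ_k (succ_k a) ∉ B`, then `Φ` contains a
colouring and omits another that agree off `b = succ_k a`. -/
theorem duty_reads_runEnd (S : CycleSystem q t) (hq : 1 ≤ q) (hN : S.Normal) {B : Finset (Fin (3 * q + 1))}
    {Φ : Set (Fin (3 * q + 1) → Fin 3)} (hG : S.edges ∈ dutyRect B Φ) {k : Fin t} {a : Fin (3 * q + 1)}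
    (haB : a ∈ B) (hbB : S.succ k a ∈ B) (hc : S.succ k (S.succ k a) ∉ B) :
    ∃ c₁ ∈ Φ, ∃ c₂ ∉ Φ, ∀ w, w ≠ S.succ k a → c₁ w = c₂ w :=
  ⟨seamRot S k a 2, holeSeam_mem_duty S hq hN hG haB hbB 2,
   seamRot S k (S.succ k a) 0, seam_not_mem_duty S hq hN hG (fun h => hc h.2) 0,
   fun w hw => (seamRot_succ_agree S hq k a w hw).symm⟩

/-- `Φ` is a `T`-JUNTA: membership depends only on the colours on `T`. -/
def IsJunta {V : Type*} (T : Finset V) (Φ : Set (V → Fin 3)) : Prop :=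
  ∀ c₁ c₂ : V → Fin 3, (∀ w ∈ T, c₁ w = c₂ w) → (c₁ ∈ Φ ↔ c₂ ∈ Φ)

/-- **Junta immunity.** A `T`-junta duty capturing a normal system must contain every run start of every ruler. -/
theorem junta_reads_runStart (S : CycleSystem q t) (hq : 1 ≤ q) (hN : S.Normal) {B T : Finset (Fin (3 * q + 1))}
    {Φ : Set (Fin (3 * q + 1) → Fin 3)} (hT : IsJunta T Φ) (hG : S.edges ∈ dutyRect B Φ) {k : Fin t}
    {a : Fin (3 * q + 1)} (ha : a ∉ B) (hbB : S.succ k a ∈ B) (hb : S.succ k (S.succ k a) ∈ B) :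
    S.succ k a ∈ T := by
  by_contra hbT
  obtain ⟨c₁, h1, c₂, h2, hagree⟩ := duty_reads_runStart S hq hN hG ha hbB hb
  refine h2 ((hT c₁ c₂ fun w hw => hagree w ?_).mp h1)
  rintro rfl
  exact hbT hw

/-- … and every run end. -/
theorem junta_reads_runEnd (S : CycleSystem q t) (hq : 1 ≤ q) (hN : S.Normal) {B T : Finset (Fin (3 * q + 1))}
    {Φ : Set (Fin (3 * q + 1) → Fin 3)} (hT : IsJunta T Φ) (hG : S.edges ∈ dutyRect B Φ) {k : Fin t}
    {a : Fin (3 * q + 1)} (haB : a ∈ B) (hbB : S.succ k a ∈ B) (hc : S.succ k (S.succ k a) ∉ B) :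
    S.succ k a ∈ T := by
  by_contra hbT
  obtain ⟨c₁, h1, c₂, h2, hagree⟩ := duty_reads_runEnd S hq hN hG haB hbB hc
  refine h2 ((hT c₁ c₂ fun w hw => hagree w ?_).mp h1)
  rintro rfl
  exact hbT hw

/-- `Φ` is invariant under every permutation of the vertices fixing `Y` pointwise ("resolution `Y`", A8/A10). -/
def InvariantOff {V : Type*} (Y : Finset V) (Φ : Set (V → Fin 3)) : Prop :=
  ∀ σ : Equiv.Perm V, (∀ y ∈ Y, σ y = y) → ∀ c : V → Fin 3, c ∈ Φ ↔ (c ∘ σ) ∈ Φ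

/-- **Profile immunity (typed, card 1; proof = three applications of `seamColour_shift` + a histogram check).**
A resolution-`Y` duty capturing a normal system pins a vertex in every balanced window: if ruler `k` runs
`a ∉ B`, then `b₁, b₂, b₃, b₄ ∈ B` consecutively, the seams based at `a` (outside `Φ`) and at `b₃` (inside `Φ`, a hole) agree
off `{b₁, b₂, b₃}` and have equal colour histograms on it, so `Y ∩ {b₁, b₂, b₃} ≠ ∅`. -/
def ProfileReadsWindows (q t : ℕ) : Prop :=
  ∀ (S : CycleSystem q t), 1 ≤ q → S.Normal → ∀ (B Y : Finset (Fin (3 * q + 1))) (Φ : Set (Fin (3 * q + 1) → Fin 3)),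
    InvariantOff Y Φ → S.edges ∈ dutyRect B Φ → ∀ (k : Fin t) (a : Fin (3 * q + 1)),
      a ∉ B → S.succ k a ∈ B → S.succ k (S.succ k a) ∈ B → S.succ k (S.succ k (S.succ k a)) ∈ B →
      S.succ k (S.succ k (S.succ k (S.succ k a))) ∈ B →
      (S.succ k a ∈ Y ∨ S.succ k (S.succ k a) ∈ Y ∨ S.succ k (S.succ k (S.succ k a)) ∈ Y)

/-! ## Card 2 — the Cayley clique model of normal systems -/

/-- `D`-STEPPED permutation of `Fin (3q+1)`: consecutive values differ (cyclically) by `≡ 2 (mod 3)`. -/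
def DStepped (σ : Equiv.Perm (Fin (3 * q + 1))) : Prop :=
  ∀ i : Fin (3 * q + 1), (σ (i + 1) - σ i).val % 3 = 2

/-- transition map "position along ruler `k` ↦ position along ruler `i`". -/
def transition (S : CycleSystem q t) (k i : Fin t) : Equiv.Perm (Fin (3 * q + 1)) :=
  (S.pos k).symm.trans (S.pos i)

theorem transition_symm (S : CycleSystem q t) (k i : Fin t) : (transition S k i).symm = transition S i k := rfl

/-- **Normality = every transition map is `D`-stepped.** -/
theorem normal_iff_dStepped (S : CycleSystem q t) :
    S.Normal ↔ ∀ i k : Fin t, i ≠ k → DStepped (transition S k i) := by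
  unfold CycleSystem.Normal DStepped transition
  constructor
  · intro h i k hik j
    have := h i k hik ((S.pos k).symm j)
    simpa [CycleSystem.succ, Equiv.trans_apply, Equiv.apply_symm_apply] using this
  · intro h i k hik v
    have := h i k hik (S.pos k v)
    simpa [CycleSystem.succ, Equiv.trans_apply, Equiv.symm_apply_apply] using this

/-- adjacency in the Cayley graph `Cay(Sym(3q+1), S_D)`, `S_D = {σ : σ and σ⁻¹ are D-stepped}`:
`π ~ π'` iff `π⁻¹π'` and `π'⁻¹π` are both `D`-stepped.  (`S_D` is symmetric, so this is an honest graph.) -/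
def CayleyAdj (π π' : Equiv.Perm (Fin (3 * q + 1))) : Prop :=
  DStepped (π.symm.trans π') ∧ DStepped (π'.symm.trans π)

theorem cayleyAdj_symm {π π' : Equiv.Perm (Fin (3 * q + 1))} (h : CayleyAdj π π') : CayleyAdj π' π :=
  ⟨h.2, h.1⟩

/-- **Normal `t`-systems are exactly the `t`-cliques of `Cay(Sym(3q+1), S_D)`** (rulers as vertices). -/
theorem normal_iff_pairwise_cayleyAdj (S : CycleSystem q t) :
    S.Normal ↔ ∀ i k : Fin t, i ≠ k → CayleyAdj (S.pos k) (S.pos i) := by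
  rw [normal_iff_dStepped]
  constructor
  · intro h i k hik
    exact ⟨h i k hik, h k i (Ne.symm hik)⟩
  · intro h i k hik
    exact (h i k hik).1

/-- the left-translation invariance that makes it a Cayley graph: relabelling the vertices by `ρ` preserves adjacency. -/
theorem cayleyAdj_relabel (ρ π π' : Equiv.Perm (Fin (3 * q + 1))) (h : CayleyAdj π π') :
    CayleyAdj (ρ.trans π) (ρ.trans π') := by
  have e1 : (ρ.trans π).symm.trans (ρ.trans π') = π.symm.trans π' := by
    ext x; simp
  have e2 : (ρ.trans π').symm.trans (ρ.trans π) = π'.symm.trans π := by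
    ext x; simp
  exact ⟨e1 ▸ h.1, e2 ▸ h.2⟩

/-- EXISTENCE THRESHOLD (card 2, typed conjecture from the first-moment count `((n/e)·3^{-(t-1)})^{n(t-1)}`):
normal `t`-systems on `3q+1` vertices exist as soon as `3q+1 ≥ C·3^t`. -/
def CayleyCliqueThreshold (C : ℕ) : Prop :=
  ∀ q t : ℕ, C * 3 ^ t ≤ 3 * q + 1 → ∃ S : CycleSystem q t, S.Normal

/-! ## Card 3 — the two-sided link ladder -/

/-- predecessor along ruler `k`. -/
def pred (S : CycleSystem q t) (k : Fin t) (v : Fin (3 * q + 1)) : Fin (3 * q + 1) :=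
  (S.pos k).symm (S.pos k v - 1)

/-- TWO-SIDED LINK TYPE of a vertex in ruler `k` at the cut `B`: (is the predecessor in `B`, is the successor in `B`). -/
def linkType (S : CycleSystem q t) (B : Finset (Fin (3 * q + 1))) (k : Fin t) (v : Fin (3 * q + 1)) :
    Bool × Bool :=
  (decide (pred S k v ∈ B), decide (S.succ k v ∈ B))

/-- the TWO-SIDED LINK CLASS of `S` at `B`: systems with the same residues everywhere (aligned) and the same two-sided
link type at every vertex of `B` in every ruler.  Its `μ_t`-mass is `≈ 2^{-tn}` (two bits per `B`-vertex per ruler). -/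
def TwoSidedClass (S : CycleSystem q t) (B : Finset (Fin (3 * q + 1))) : Set (CycleSystem q t) :=
  {S' | (∀ k v, (S'.pos k v).val % 3 = (S.pos k v).val % 3) ∧ ∀ k, ∀ v ∈ B, linkType S' B k v = linkType S B k v}

/-- DARKNESS OF TWO-SIDED CLASSES at parameter `t` (card 3): every Alice/Bob hybrid of two distinct normal members of a
common two-sided link class is non-3-colourable.  For FIXED `t` this statement, if true for all large `q`, REFUTES
`X1(μ_t)` along `n = 3q+1 → ∞` (class mass `2^{-tn}` against the threshold `2^{-(n/2)log₂ n - Cn}`); the proxy data of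
the card says it is true at SHIFT level for `t ≥ 6` and false (rate ≥ 20 %) for one-sided classes. -/
def TwoSidedDark (q t : ℕ) : Prop :=
  ∀ (S S' : CycleSystem q t) (B : Finset (Fin (3 * q + 1))), S.Normal → S'.Normal → S' ∈ TwoSidedClass S B →
    S'.edges ≠ S.edges → ¬ Col3 (aliceSide B S.edges ∪ bobSide B S'.edges)

end Summit.PneNP.PneNP.Cruxes.FoolingMeasure.IdeasR2s2g7
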